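import Summits.FinalStateConjecture.FinalStateConjecture.Theorems.PhaseMixingCaptureCaptureSufficesTameNoC0GlueSets
import Summits.FinalStateConjecture.FinalStateConjecture.Theorems.PhaseMixingCaptureCaptureSufficesTameNoC0FlatGenerators
import HarnessLib

/-!
# `CaptureSufficesTame` (stmt-FinalStateConjecture-17270), line `only-the-third-law-is-generic`: glue stub
# `stub_noC0_glue` (oriented form), helper file 4 — generators through boundary points near the base point

(H-gen) for the pulled-back relative causal future `C = Ω' ∩ Φ⁻¹(closure J)`, `O = Ω' ∩ Φ⁻¹(interior J)` of an
oriented `ε`-isometry `Φ` of a Kerr chunk (namespace `NoC0Glue`): with the explicit radius `d₁ = dist(p₀, Ω'ᶜ)/4`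
(uniform in the chart), every boundary point
`x ∈ C ∖ O`, `x ≠ p₀`, with `x⁰ < p₀⁰ + d₁`, `‖x − p₀‖ < d₁` lies on a `t*`-parametrised `Φ^*η`-null differentiable
path from `p₀` inside `C ∖ O` that comes arbitrarily close to `Ω'ᶜ`:

* `noExit` — the exit branch of the flat generator lemma (brick F2, `stub_noC0_flatGenerators`) is impossible near
  `p₀`: along the pulled-back backward null segment `t*` decreases but stays `≥ p₀⁰` (H-t), and the speed bound of
  brick K3 confines the segment to the compact ball `closedBall(x, 2d₁) ⊆ Ω'`, so its endpoint stays in `U`;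
* `ray_curve` — the lit ray `P + λ(Φ x − P)` extended maximally inside `U` (`ray_sup`), pulled back by `G` and
  reparametrised by `t*` (`reparam`), with the approach to `Ω'ᶜ` from the compactness of `closure Ω'`;
* `gen` — (H-gen) assembled; `stub_noC0_glueGen` — the same as a closed statement (registered helper sub-goal).

References: S. W. Hawking, G. F. R. Ellis, *The large scale structure of space-time*, 1973, Prop. 6.3.1;
B. O'Neill, *Semi-Riemannian geometry*, 1983, Ch. 14, Cor. 14.27; R. Penrose, *Techniques of differential topology
in relativity*, 1972, §5.
-/

-- the doubled `FinalStateConjecture.FinalStateConjecture` path component trips dupNamespace (as in the skeleton)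
set_option linter.dupNamespace false
set_option maxSynthPendingDepth 3

noncomputable section

open Set Filter Function Metric
open scoped Topology ContDiff

namespace Summit.FinalStateConjecture.FinalStateConjecture.Theorems.PhaseMixingCaptureCaptureSufficesTame

open Literature.Geometry.Lorentzian

namespace NoC0Glue

section Gen

variable {M a ε : ℝ} {Ω Ω' : Set E4} {Φ G : E4 → E4} {p₀ : E4} {J : Set E4}

/-- **The exit branch of the flat generator lemma is impossible near the base point.** Let `x ∈ C` with
`x⁰ < p₀⁰ + d₁`, `‖x − p₀‖ < d₁`, `ball(p₀, 4d₁) ⊆ Ω'`, and let `Φ x − s d` (`d` future null, `0 ≤ s < μ`) be a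
backward null segment inside `U ∩ closure J`. Then its endpoint `Φ x − μ d` still lies in `U = Φ '' Ω'`: the
pulled-back points `ν(s) = G(Φ x − s d)` lie in `C`, so `t*(ν s) ≥ p₀⁰` (H-t), and by the kinematic brick K3
along the pulled-back segment `‖x − ν s‖ ≤ 2 (x⁰ − (ν s)⁰) ≤ 2 (x⁰ − p₀⁰) < 2d₁`; hence `ν s` stays in the compact
ball `closedBall(x, 2d₁) ⊆ Ω'`, and a limit point `z` of `ν(s)`, `s ↑ μ`, has `Φ z = Φ x − μ d`. [folklore] -/
theorem noExit (hM : 0 ≤ M) (hΩ : IsOpen Ω) (hΩext : Ω ⊆ (Kerr.exterior M a : Set E4)) (hΦ : ContDiffOn ℝ ∞ Φ Ω)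
    (hε : ε ≤ 1 / 80)
    (hclose : ∀ y ∈ Ω, ‖MetricCoord.pullMetric (fun _ ↦ Minkowski.bilin) Φ y - Kerr.bilin M a y‖ ≤ ε)
    (hO : ∀ y ∈ Ω, ∀ v : E4, MetricCoord.pullMetric (fun _ ↦ Minkowski.bilin) Φ y v v ≤ 0 → 0 < v 0 →
      0 < (fderiv ℝ Φ y v) 0)
    (hG : ∀ y ∈ Ω, G (Φ y) = y) (hΩ'Ω : Ω' ⊆ Ω) (hp₀ : p₀ ∈ Ω')
    (hJ : J = {Y | Y ∈ Φ '' Ω' ∧ (Y = Φ p₀ ∨ ∃ (γ : ℝ → E4) (a b : ℝ), a < b ∧ γ a = Φ p₀ ∧ γ b = Y ∧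
      ∀ t ∈ Set.Icc a b, γ t ∈ Φ '' Ω' ∧ ∃ v : E4, HasDerivAt γ v t ∧ Minkowski.bilin v v ≤ 0 ∧ 0 < v 0)})
    {d₁ : ℝ} (hball : ball p₀ (4 * d₁) ⊆ Ω') {x : E4} (hx : x ∈ Ω' ∩ Φ ⁻¹' closure J)
    (hxt : x 0 < p₀ 0 + d₁) (hxn : ‖x - p₀‖ < d₁) {d : E4} (hd : Minkowski.bilin d d = 0) (hd0 : 0 < d 0)
    {μ : ℝ} (hμ : 0 < μ) (hseg : ∀ s ∈ Ico 0 μ, Φ x - s • d ∈ Φ '' Ω' ∧ Φ x - s • d ∈ closure J) :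
    Φ x - μ • d ∈ Φ '' Ω' := by
  have hKΩ' : closedBall x (2 * d₁) ⊆ Ω' := by
    intro z hz
    apply hball
    rw [mem_closedBall, dist_eq_norm] at hz
    rw [mem_ball, dist_eq_norm]
    calc ‖z - p₀‖ ≤ ‖z - x‖ + ‖x - p₀‖ := norm_sub_le_norm_sub_add_norm_sub _ _ _
      _ < 2 * d₁ + d₁ := add_lt_add_of_le_of_lt hz hxn
      _ ≤ 4 * d₁ := by linarith [norm_nonneg (x - p₀)]
  -- each pulled-back point of the segment lies in the ball
  have hν : ∀ s ∈ Ico 0 μ, G (Φ x - s • d) ∈ closedBall x (2 * d₁) := by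
    intro s hs
    have hσ : ∀ u ∈ Icc 0 s, (fun u ↦ Φ x - (s - u) • d) u ∈ Φ '' Ω' ∧
        ∃ w : E4, HasDerivAt (fun u ↦ Φ x - (s - u) • d) w u ∧ Minkowski.bilin w w ≤ 0 ∧ 0 < w 0 := by
      intro u hu
      refine ⟨(hseg (s - u) ⟨by linarith [hu.2], by linarith [hu.1, hs.2]⟩).1, d, ?_, hd.le, hd0⟩
      have h := (((hasDerivAt_id' u).const_sub s).smul_const d).const_sub (Φ x)
      exact h.congr_deriv (by simp)
    have hpull := pullback_causalPath hM hΩ hΩext hΦ hε hclose hO hG hΩ'Ω hσ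
    have hK3 := (kerr_time_strictMonoOn_and_norm_sub_le M a
      (fun u ↦ MetricCoord.pullMetric (fun _ ↦ Minkowski.bilin) Φ ((G ∘ fun u ↦ Φ x - (s - u) • d) u))
      (G ∘ fun u ↦ Φ x - (s - u) • d) 0 s hM hs.1 (fun u hu ↦ ⟨(hpull u hu).2.1, (hpull u hu).2.2⟩)).2
    simp only [comp_apply, sub_self, zero_smul, sub_zero, hG x (hΩ'Ω hx.1)] at hK3
    have hC : G (Φ x - s • d) ∈ Ω' ∩ Φ ⁻¹' closure J := by
      obtain ⟨y', hy', hyeq⟩ := (hseg s hs).1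
      rw [← hyeq, hG y' (hΩ'Ω hy')]
      refine ⟨hy', ?_⟩
      show Φ y' ∈ closure J
      rw [hyeq]
      exact (hseg s hs).2
    have ht := base_time_le hM hΩ hΩext hΦ hε hclose hO hG hΩ'Ω hp₀ hJ hC
    rw [mem_closedBall, dist_eq_norm, norm_sub_rev]
    linarith
  obtain ⟨u, -, huI, hu⟩ := exists_seq_strictMono_tendsto' hμ
  have hlim : Tendsto (fun n ↦ Φ x - u n • d) atTop (𝓝 (Φ x - μ • d)) :=
    tendsto_const_nhds.sub (hu.smul_const d)
  exact mem_image_of_tendsto hΩ hΦ hΩ'Ω hG (isCompact_closedBall x (2 * d₁)) hKΩ'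
    (fun n ↦ (hseg (u n) ⟨(huI n).1.le, (huI n).2⟩).1) (fun n ↦ hν (u n) ⟨(huI n).1.le, (huI n).2⟩) hlim

/-- **The lit ray through a boundary point, pulled back and parametrised by `t*`.** Let `x ∈ Ω'` with
`Φ x = P + d'`, `d'` future null, and `P + λ d' ∈ U = Φ '' Ω'` for `λ ∈ [0, 1]`. Extend the ray maximally forward
inside `U` (`ray_sup`: parameters `[0, Λ)`, `Λ > 1`, exit at `Λ`) and a little backward (`U` open at `P`); its
points are in `closure J ∖ interior J` (brick F1 (ii)); pull it back by `G` (a `Φ^*η`-null future differentiable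
curve, `pullback_causalPath`) and reparametrise by `t*` (`reparam`). The resulting `μ` runs inside `C ∖ O` from
`μ(p₀⁰) = p₀` through `μ(x⁰) = x` with `(μ t)⁰ = t` on `[p₀⁰, E)`, `E = sup t*`, and comes arbitrarily close to
`Ω'ᶜ` as `t ↑ E` (otherwise the pulled-back points would accumulate in a compact subset of `Ω'` and the exit point
`P + Λ d'` would lie in `U`). Hawking–Ellis 1973, Prop. 6.3.1 / O'Neill 1983, Ch. 14, Cor. 14.27 (boundary
generators), transported through the chart. [cite: ONeill1983, Ch. 14, Cor. 14.27] -/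
theorem ray_curve (hM : 0 ≤ M) (hΩ : IsOpen Ω) (hΩext : Ω ⊆ (Kerr.exterior M a : Set E4))
    (hΦ : ContDiffOn ℝ ∞ Φ Ω) (hε : ε ≤ 1 / 80)
    (hclose : ∀ y ∈ Ω, ‖MetricCoord.pullMetric (fun _ ↦ Minkowski.bilin) Φ y - Kerr.bilin M a y‖ ≤ ε)
    (hO : ∀ y ∈ Ω, ∀ v : E4, MetricCoord.pullMetric (fun _ ↦ Minkowski.bilin) Φ y v v ≤ 0 → 0 < v 0 →
      0 < (fderiv ℝ Φ y v) 0)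
    (hG : ∀ y ∈ Ω, G (Φ y) = y) (hΩ' : IsOpen Ω') (hclΩ : closure Ω' ⊆ Ω) (hcpt : IsCompact (closure Ω'))
    (hp₀ : p₀ ∈ Ω')
    (hJ : J = {Y | Y ∈ Φ '' Ω' ∧ (Y = Φ p₀ ∨ ∃ (γ : ℝ → E4) (a b : ℝ), a < b ∧ γ a = Φ p₀ ∧ γ b = Y ∧
      ∀ t ∈ Set.Icc a b, γ t ∈ Φ '' Ω' ∧ ∃ v : E4, HasDerivAt γ v t ∧ Minkowski.bilin v v ≤ 0 ∧ 0 < v 0)})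
    {x : E4} (hx : x ∈ Ω') {d' : E4} (hd' : Minkowski.bilin d' d' = 0) (hd'0 : 0 < d' 0)
    (hX : Φ p₀ + d' = Φ x) (h1 : ∀ l ∈ Icc (0 : ℝ) 1, Φ p₀ + l • d' ∈ Φ '' Ω') :
    ∃ (μ : ℝ → E4) (E : ℝ), x 0 < E ∧ μ (p₀ 0) = p₀ ∧ μ (x 0) = x ∧
      (∀ t ∈ Ico (p₀ 0) E, μ t ∈ Ω' ∩ Φ ⁻¹' closure J ∧ μ t ∉ Ω' ∩ Φ ⁻¹' interior J ∧ μ t 0 = t ∧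
        ∃ v : E4, HasDerivAt μ v t ∧ MetricCoord.pullMetric (fun _ ↦ Minkowski.bilin) Φ (μ t) v v ≤ 0 ∧
          v 0 = 1) ∧
      (∀ η > 0, ∀ t₀ < E, ∃ t, t₀ ≤ t ∧ p₀ 0 ≤ t ∧ t < E ∧ infDist (μ t) Ω'ᶜ < η) := by
  have hΩ'Ω : Ω' ⊆ Ω := subset_closure.trans hclΩ
  have hU : IsOpen (Φ '' Ω') := isOpen_image hM hΩ hΩext hΦ (by linarith) hclose hΩ' hΩ'Ω
  have hUb : Bornology.IsBounded (Φ '' Ω') :=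
    (hcpt.image_of_continuousOn (hΦ.continuousOn.mono hclΩ)).isBounded.subset (image_mono subset_closure)
  obtain ⟨-, hF2⟩ := stub_noC0_flatBasics (Φ '' Ω') hU (Φ p₀) ⟨p₀, hp₀, rfl⟩ J hJ
  have hd'ne : d' ≠ 0 := by
    intro h
    rw [h] at hd'0
    simp at hd'0
  obtain ⟨Λ, hΛ1, hgood, hnot⟩ := ray_sup hU hUb hd'ne h1
  -- backward room at `P`
  obtain ⟨ρ, hρ, hρball⟩ := Metric.isOpen_iff.1 hU (Φ p₀) ⟨p₀, hp₀, rfl⟩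
  have hdn : 0 < ‖d'‖ := norm_pos_iff.2 hd'ne
  obtain ⟨l₀, hl₀⟩ : ∃ l₀, l₀ = ρ / ‖d'‖ := ⟨_, rfl⟩
  have hl₀0 : 0 < l₀ := by rw [hl₀]; positivity
  have hIU : ∀ l ∈ Ioo (-l₀) Λ, Φ p₀ + l • d' ∈ Φ '' Ω' := by
    intro l hl
    rcases lt_or_ge l 0 with hneg | hnn
    · apply hρball
      rw [mem_ball, dist_eq_norm, add_sub_cancel_left, norm_smul, Real.norm_eq_abs, abs_of_neg hneg]
      have : -l < ρ / ‖d'‖ := by rw [← hl₀]; linarith [hl.1]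
      rwa [lt_div_iff₀ hdn] at this
    · exact hgood l ⟨hnn, hl.2⟩
  have hRd : ∀ l : ℝ, HasDerivAt (fun l : ℝ ↦ Φ p₀ + l • d') d' l := fun l ↦ by
    have h := ((hasDerivAt_id' l).smul_const d').const_add (Φ p₀)
    exact h.congr_deriv (by simp)
  have hγ : ∀ l ∈ Ioo (-l₀) Λ, (fun l : ℝ ↦ Φ p₀ + l • d') l ∈ Φ '' Ω' ∧
      ∃ w : E4, HasDerivAt (fun l : ℝ ↦ Φ p₀ + l • d') w l ∧ Minkowski.bilin w w ≤ 0 ∧ 0 < w 0 :=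
    fun l hl ↦ ⟨hIU l hl, d', hRd l, hd'.le, hd'0⟩
  have hpull := pullback_causalPath hM hΩ hΩext hΦ hε hclose hO hG hΩ'Ω hγ
  obtain ⟨hmono, φ, hφf, -, hφ⟩ := reparam isOpen_Ioo ordConnected_Ioo (c := G ∘ fun l : ℝ ↦ Φ p₀ + l • d')
    (fun l hl ↦ by
      obtain ⟨-, -, v, hv, -, hv0⟩ := hpull l hl
      exact ⟨v, hv, hv0⟩)
  -- notation-free abbreviations
  set c : ℝ → E4 := G ∘ fun l : ℝ ↦ Φ p₀ + l • d' with hc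
  have h0I : (0 : ℝ) ∈ Ioo (-l₀) Λ := ⟨by linarith, by linarith⟩
  have h1I : (1 : ℝ) ∈ Ioo (-l₀) Λ := ⟨by linarith, hΛ1⟩
  have hc0 : c 0 = p₀ := by simp [hc, hG p₀ (hΩ'Ω hp₀)]
  have hc1 : c 1 = x := by simp [hc, hX, hG x (hΩ'Ω hx)]
  have hΦc : ∀ l ∈ Ioo (-l₀) Λ, Φ (c l) = Φ p₀ + l • d' := by
    intro l hl
    obtain ⟨y', hy', hyeq⟩ := hIU l hl
    simp only [hc, comp_apply]
    rw [← hyeq, hG y' (hΩ'Ω hy')]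
  have hcont : ∀ l ∈ Ioo (-l₀) Λ, ContinuousAt (fun l ↦ c l 0) l := by
    intro l hl
    obtain ⟨-, -, v, hv, -, -⟩ := hpull l hl
    exact (hasDerivAt_timeCoord hv).continuousAt
  -- the supremum `E` of `t*` along the forward ray
  have hTne : ((fun l ↦ c l 0) '' Ico 0 Λ).Nonempty := ⟨c 0 0, 0, ⟨le_rfl, by linarith⟩, rfl⟩
  have hTbdd : BddAbove ((fun l ↦ c l 0) '' Ico 0 Λ) := by
    obtain ⟨Rb, hRb⟩ := hcpt.bddAbove_image (f := fun z : E4 ↦ z 0) NoC0Flat.continuous_apply_zero.continuousOn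
    refine ⟨Rb, ?_⟩
    rintro _ ⟨l, hl, rfl⟩
    exact hRb ⟨c l, subset_closure (hpull l ⟨by linarith [hl.1], hl.2⟩).1, rfl⟩
  set E := sSup ((fun l ↦ c l 0) '' Ico 0 Λ) with hE
  have hltE : ∀ l ∈ Ico 0 Λ, c l 0 < E := by
    intro l hl
    have hl' : (l + Λ) / 2 ∈ Ico 0 Λ := ⟨by linarith [hl.1], by linarith [hl.2]⟩
    have hlt : c l 0 < c ((l + Λ) / 2) 0 :=
      hmono ⟨by linarith [hl.1], hl.2⟩ ⟨by linarith [hl.1], hl'.2⟩ (by linarith [hl.2])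
    exact hlt.trans_le (le_csSup hTbdd ⟨_, hl', rfl⟩)
  have hpre : ∀ t, p₀ 0 ≤ t → t < E → ∃ l ∈ Ico 0 Λ, c l 0 = t := by
    intro t ht1 ht2
    obtain ⟨_, ⟨l₂, hl₂, rfl⟩, htl₂⟩ := exists_lt_of_lt_csSup hTne ht2
    have hco : ContinuousOn (fun l ↦ c l 0) (Icc 0 l₂) := fun l hl ↦
      (hcont l ⟨by linarith [hl.1], hl.2.trans_lt hl₂.2⟩).continuousWithinAt
    obtain ⟨l, hl, hfl⟩ := intermediate_value_Icc hl₂.1 hco ⟨by rw [hc0]; exact ht1, htl₂.le⟩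
    exact ⟨l, ⟨hl.1, hl.2.trans_lt hl₂.2⟩, hfl⟩
  refine ⟨c ∘ φ, E, ?_, ?_, ?_, fun t ht ↦ ?_, fun η hη t₀ ht₀ ↦ ?_⟩
  · rw [← hc1]
    exact hltE 1 ⟨zero_le_one, hΛ1⟩
  · show c (φ (p₀ 0)) = p₀
    rw [← hc0, hφf 0 h0I]
  · show c (φ (x 0)) = x
    rw [← hc1, hφf 1 h1I]
  · obtain ⟨l, hl, hfl⟩ := hpre t ht.1 ht.2
    have hlI : l ∈ Ioo (-l₀) Λ := ⟨by linarith [hl.1], hl.2⟩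
    have hφt : φ t = l := by rw [← hfl, hφf l hlI]
    obtain ⟨-, hft, v, hvd, hd⟩ := hφ t ⟨l, hlI, hfl⟩
    obtain ⟨hlΩ', -, v', hv'd, hBv', hv'0⟩ := hpull l hlI
    have hvv' : v = v' := by
      rw [hφt] at hvd
      exact hvd.unique hv'd
    have hpos : (c ∘ φ) t = c l := by
      show c (φ t) = c l
      rw [hφt]
    obtain ⟨hcl, hint⟩ := hF2 d' hd' hd'0 l hl.1 (fun s hs ↦ hgood s ⟨hs.1, hs.2.trans_lt hl.2⟩) l ⟨hl.1, le_rfl⟩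
    refine ⟨⟨by rw [hpos]; exact hlΩ', ?_⟩, fun hO' ↦ hint ?_, hft, _, hd, ?_,
      inv_smul_apply_zero (by rw [hvv']; exact hv'0)⟩
    · show Φ ((c ∘ φ) t) ∈ closure J
      rw [hpos, hΦc l hlI]
      exact hcl
    · have h2 := hO'.2
      rw [mem_preimage, hpos, hΦc l hlI] at h2
      exact h2
    · rw [hvv', hpos]
      exact smul_causal _ hBv' _
  · -- the exit clause
    by_contra hcon
    push Not at hcon
    obtain ⟨_, ⟨l₂, hl₂, rfl⟩, htl₂⟩ := exists_lt_of_lt_csSup hTne ht₀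
    have hK : IsCompact (closure Ω' ∩ {z : E4 | η ≤ infDist z Ω'ᶜ}) :=
      hcpt.inter_right (isClosed_le continuous_const (continuous_infDist_pt _))
    have hKΩ' : closure Ω' ∩ {z : E4 | η ≤ infDist z Ω'ᶜ} ⊆ Ω' := by
      intro z hz
      by_contra h
      have h0 := infDist_zero_of_mem (mem_compl h)
      have h2 : η ≤ infDist z Ω'ᶜ := hz.2
      linarith
    have hinK : ∀ l ∈ Ico l₂ Λ, c l ∈ closure Ω' ∩ {z : E4 | η ≤ infDist z Ω'ᶜ} := by
      intro l hl
      have hl' : l ∈ Ico 0 Λ := ⟨hl₂.1.trans hl.1, hl.2⟩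
      have hlI : l ∈ Ioo (-l₀) Λ := ⟨by linarith [hl'.1], hl.2⟩
      refine ⟨subset_closure (hpull l hlI).1, ?_⟩
      have h := hcon (c l 0) (htl₂.le.trans (hmono.monotoneOn ⟨by linarith [hl₂.1], hl₂.2⟩ hlI hl.1))
        (by rw [← hc0]; exact hmono.monotoneOn h0I hlI hl'.1) (hltE l hl')
      have heq : (c ∘ φ) (c l 0) = c l := by
        show c (φ (c l 0)) = c l
        rw [hφf l hlI]
      rw [heq] at h
      exact h
    obtain ⟨u, -, huI, hu⟩ := exists_seq_strictMono_tendsto' hl₂.2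
    have hlim : Tendsto (fun n ↦ Φ p₀ + u n • d') atTop (𝓝 (Φ p₀ + Λ • d')) :=
      tendsto_const_nhds.add (hu.smul_const d')
    exact hnot (mem_image_of_tendsto hΩ hΦ hΩ'Ω hG hK hKΩ'
      (fun n ↦ hIU (u n) ⟨by linarith [(huI n).1, hl₂.1], (huI n).2⟩)
      (fun n ↦ hinK (u n) ⟨(huI n).1.le, (huI n).2⟩) hlim)

/-- **(H-gen) generators through boundary points near the base point.** With the EXPLICIT radius
`d₁ = dist(p₀, Ω'ᶜ)/4` (uniform in the chart `Φ`): every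
`x ∈ C ∖ O`, `x ≠ p₀`, with `x⁰ < p₀⁰ + d₁` and `‖x − p₀‖ < d₁` lies on a `t*`-parametrised `Φ^*η`-null differentiable
path `μ` from `p₀` (`μ(p₀⁰) = p₀`, `μ(x⁰) = x`) running inside `C ∖ O` on `[p₀⁰, E)` and coming arbitrarily close
to `Ω'ᶜ` as `t ↑ E`. By brick F2 (`stub_noC0_flatGenerators`, `U = Φ '' Ω'` is bounded) the boundary point `Φ x` of
the flat relative causal future is backward-lit until the vertex `P = Φ p₀` or the exit from `U`; the exit branch is
impossible near `p₀` (`noExit`), and the lit ray gives `μ` (`ray_curve`). Hawking–Ellis 1973, Prop. 6.3.1;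
O'Neill 1983, Ch. 14, Cor. 14.27. [cite: HawkingEllis1973, Prop. 6.3.1] -/
theorem gen (hM : 0 ≤ M) (hΩ : IsOpen Ω) (hΩext : Ω ⊆ (Kerr.exterior M a : Set E4))
    (hΦ : ContDiffOn ℝ ∞ Φ Ω) (hε : ε ≤ 1 / 80)
    (hclose : ∀ y ∈ Ω, ‖MetricCoord.pullMetric (fun _ ↦ Minkowski.bilin) Φ y - Kerr.bilin M a y‖ ≤ ε)
    (hO : ∀ y ∈ Ω, ∀ v : E4, MetricCoord.pullMetric (fun _ ↦ Minkowski.bilin) Φ y v v ≤ 0 → 0 < v 0 →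
      0 < (fderiv ℝ Φ y v) 0)
    (hG : ∀ y ∈ Ω, G (Φ y) = y) (hΩ' : IsOpen Ω') (hclΩ : closure Ω' ⊆ Ω) (hcpt : IsCompact (closure Ω'))
    (hp₀ : p₀ ∈ Ω')
    (hJ : J = {Y | Y ∈ Φ '' Ω' ∧ (Y = Φ p₀ ∨ ∃ (γ : ℝ → E4) (a b : ℝ), a < b ∧ γ a = Φ p₀ ∧ γ b = Y ∧
      ∀ t ∈ Set.Icc a b, γ t ∈ Φ '' Ω' ∧ ∃ v : E4, HasDerivAt γ v t ∧ Minkowski.bilin v v ≤ 0 ∧ 0 < v 0)}) :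
    ∀ x ∈ Ω' ∩ Φ ⁻¹' closure J, x ∉ Ω' ∩ Φ ⁻¹' interior J → x ≠ p₀ → x 0 < p₀ 0 + infDist p₀ Ω'ᶜ / 4 →
      ‖x - p₀‖ < infDist p₀ Ω'ᶜ / 4 →
      ∃ (μ : ℝ → E4) (E : ℝ), x 0 < E ∧ μ (p₀ 0) = p₀ ∧ μ (x 0) = x ∧
        (∀ t ∈ Ico (p₀ 0) E, μ t ∈ Ω' ∩ Φ ⁻¹' closure J ∧ μ t ∉ Ω' ∩ Φ ⁻¹' interior J ∧ μ t 0 = t ∧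
          ∃ v : E4, HasDerivAt μ v t ∧ MetricCoord.pullMetric (fun _ ↦ Minkowski.bilin) Φ (μ t) v v ≤ 0 ∧
            v 0 = 1) ∧
        (∀ η > 0, ∀ t₀ < E, ∃ t, t₀ ≤ t ∧ p₀ 0 ≤ t ∧ t < E ∧ infDist (μ t) Ω'ᶜ < η) := by
  have hΩ'Ω : Ω' ⊆ Ω := subset_closure.trans hclΩ
  intro x hx hxO hxp hxt hxn
  have hball : ball p₀ (4 * (infDist p₀ Ω'ᶜ / 4)) ⊆ Ω' := by
    intro z hz
    by_contra hzΩ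
    have h1 := infDist_le_dist_of_mem (x := p₀) (mem_compl hzΩ)
    rw [mem_ball, dist_comm] at hz
    linarith
  -- the flat generator lemma at `X = Φ x`
  have hU : IsOpen (Φ '' Ω') := isOpen_image hM hΩ hΩext hΦ (by linarith) hclose hΩ' hΩ'Ω
  have hUb : Bornology.IsBounded (Φ '' Ω') :=
    (hcpt.image_of_continuousOn (hΦ.continuousOn.mono hclΩ)).isBounded.subset (image_mono subset_closure)
  have hXP : Φ x ≠ Φ p₀ := by
    intro h
    apply hxp
    rw [← hG x (hΩ'Ω hx.1), h, hG p₀ (hΩ'Ω hp₀)]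
  obtain ⟨d, hd, hd0, μ, hμ, hseg, hend⟩ := stub_noC0_flatGenerators stub_noC0_flatBasics (Φ '' Ω') hU hUb
    (Φ p₀) ⟨p₀, hp₀, rfl⟩ J hJ (Φ x) ⟨x, hx.1, rfl⟩ hx.2 (fun h ↦ hxO ⟨hx.1, h⟩) hXP
  -- the exit branch is impossible
  have hlit : Φ x - μ • d = Φ p₀ := by
    rcases hend with h | h
    · exact h
    · exact absurd (noExit hM hΩ hΩext hΦ hε hclose hO hG hΩ'Ω hp₀ hJ hball hx hxt hxn hd hd0 hμ
        (fun s hs ↦ ⟨(hseg s hs).1, (hseg s hs).2.1⟩)) h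
  -- the lit ray `P + l (μ d)`, `l ∈ [0, 1]`, lies in `U`
  refine ray_curve hM hΩ hΩext hΦ hε hclose hO hG hΩ' hclΩ hcpt hp₀ hJ hx.1 (d' := μ • d) ?_ ?_ ?_ ?_
  · rw [NoC0Flat.bilin_smul_self, hd, mul_zero]
  · rw [PiLp.smul_apply, smul_eq_mul]
    exact mul_pos hμ hd0
  · rw [← hlit, sub_add_cancel]
  · intro l hl
    rcases hl.1.eq_or_lt with h0 | hpos
    · rw [← h0, zero_smul, add_zero]
      exact ⟨p₀, hp₀, rfl⟩
    · have hmem := (hseg ((1 - l) * μ) ⟨by nlinarith [hl.2], by nlinarith [hl.2]⟩).1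
      have heq : Φ p₀ + l • μ • d = Φ x - ((1 - l) * μ) • d := by
        rw [← hlit]
        module
      rw [heq]
      exact hmem

end Gen

end NoC0Glue

open NoC0Glue in
/-- **(H-gen) as a closed statement (registered helper sub-goal `stub_noC0_glueGen` of the glue stub).** For an
oriented `ε`-isometry `Φ` (`ε ≤ 1/80`, injective and `C^∞` on the open `Ω ⊆` Kerr exterior, `0 ≤ M`), a chunk `Ω'`
(open, `closure Ω' ⊆ Ω` compact), `p₀ ∈ Ω'`, and `J` the flat causal future of `Φ p₀` inside `Φ '' Ω'`: with the
explicit radius `d₁ = dist(p₀, Ω'ᶜ)/4`, every `x ∈ C ∖ O` (`C = Ω' ∩ Φ⁻¹(closure J)`, `O = Ω' ∩ Φ⁻¹(interior J)`),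
`x ≠ p₀`, with `x⁰ < p₀⁰ + d₁`, `‖x − p₀‖ < d₁` lies on a `t*`-parametrised `Φ^*η`-causal differentiable path `μ`
from `p₀` inside `C ∖ O` on `[p₀⁰, E)`, `E > x⁰`, which comes arbitrarily close to `Ω'ᶜ` as `t ↑ E` (boundary generators,
Hawking–Ellis 1973, Prop. 6.3.1, transported through the chart). [cite: HawkingEllis1973, Prop. 6.3.1] -/
theorem stub_noC0_glueGen :
    ∀ (M a : ℝ) (Ω Ω' : Set E4) (Φ : E4 → E4) (ε : ℝ) (p₀ : E4), 0 ≤ M → IsOpen Ω →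
      Ω ⊆ (Kerr.exterior M a : Set E4) → IsOpen Ω' → closure Ω' ⊆ Ω → IsCompact (closure Ω') → p₀ ∈ Ω' →
      ContDiffOn ℝ ∞ Φ Ω → InjOn Φ Ω → ε ≤ 1 / 80 →
      (∀ y ∈ Ω, ‖MetricCoord.pullMetric (fun _ ↦ Minkowski.bilin) Φ y - Kerr.bilin M a y‖ ≤ ε) →
      (∀ y ∈ Ω, ∀ v : E4, MetricCoord.pullMetric (fun _ ↦ Minkowski.bilin) Φ y v v ≤ 0 → 0 < v 0 →
        0 < (fderiv ℝ Φ y v) 0) →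
      ∀ J : Set E4,
        J = {Y | Y ∈ Φ '' Ω' ∧ (Y = Φ p₀ ∨ ∃ (γ : ℝ → E4) (a b : ℝ), a < b ∧ γ a = Φ p₀ ∧ γ b = Y ∧
              ∀ t ∈ Set.Icc a b, γ t ∈ Φ '' Ω' ∧
                ∃ v : E4, HasDerivAt γ v t ∧ Minkowski.bilin v v ≤ 0 ∧ 0 < v 0)} →
      ∀ x ∈ Ω' ∩ Φ ⁻¹' closure J, x ∉ Ω' ∩ Φ ⁻¹' interior J → x ≠ p₀ → x 0 < p₀ 0 + infDist p₀ Ω'ᶜ / 4 →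
        ‖x - p₀‖ < infDist p₀ Ω'ᶜ / 4 →
        ∃ (μ : ℝ → E4) (E : ℝ), x 0 < E ∧ μ (p₀ 0) = p₀ ∧ μ (x 0) = x ∧
          (∀ t ∈ Ico (p₀ 0) E, μ t ∈ Ω' ∩ Φ ⁻¹' closure J ∧ μ t ∉ Ω' ∩ Φ ⁻¹' interior J ∧ μ t 0 = t ∧
            ∃ v : E4, HasDerivAt μ v t ∧
              MetricCoord.pullMetric (fun _ ↦ Minkowski.bilin) Φ (μ t) v v ≤ 0 ∧ v 0 = 1) ∧
          (∀ η > 0, ∀ t₀ < E, ∃ t, t₀ ≤ t ∧ p₀ 0 ≤ t ∧ t < E ∧ infDist (μ t) Ω'ᶜ < η) := by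
  intro M a Ω Ω' Φ ε p₀ hM hΩ hΩext hΩ' hclΩ hcpt hp₀ hΦ hinj hε hclose hO J hJ
  have hG : ∀ y ∈ Ω, invFunOn Φ Ω (Φ y) = y := fun y hy ↦ hinj.leftInvOn_invFunOn hy
  exact gen hM hΩ hΩext hΦ hε hclose hO hG hΩ' hclΩ hcpt hp₀ hJ

end Summit.FinalStateConjecture.FinalStateConjecture.Theorems.PhaseMixingCaptureCaptureSufficesTame

end
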